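import Mathlib
import Summits.Ventures.HodgeRepro2.T5ProfiniteDistribution

/-!
# T5ProfiniteDistributionMeasure — every bounded compatible system on the levels of a presented
profinite space IS a bounded measure: the Riemann-sum construction, and the bijection
`{bounded measures on X} ≃ lim_k A[F k]`

Tier-5 support for route-3's §G (route/T5-CHECK-G-p7.md §3 S1 / S2 / S4, §20.2): the converse
of T5ProfiniteDistribution.  For a compact metric space `X` with a presentation `P` as an inverse
limit of finite sets (`Γ⁻ ≅ ℤ_p^δ ≅ lim_k (ℤ/p^k)^δ`, `Γ_𝔭 ≅ ℤ_p ≅ lim_k ℤ/p^k`) and a bounded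
compatible system `d` on the levels (an element of `lim_k A[F k]` = `W[[Γ]]` as printed):

* `riemann d φ k := Σ_{a ∈ F k} φ(â) · d k a` (`â` a chosen point of the fibre of `a`) — the
  Riemann sums; additive and `A`-linear in `φ`, `‖·‖ ≤ bound · ‖φ‖` (ultrametric);
* the consecutive difference is `Σ_{b ∈ F (k+1)} (φ(b̂) − φ(r̂es b)) · d (k+1) b` through the
  compatibility of `d`, and `b̂`, `r̂es b` lie in one fibre of level `k`; the fibres shrink, `φ` is
  uniformly continuous on the compact `X`, so the Riemann sums are CAUCHY (`cauchySeq_riemann`,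
  the ultrametric inequality on the telescoping sum);
* `ofDistribution d : C(X, A) →ₗ[A] A` — the limit, a measure bounded by `d.bound`;
* `coord_ofDistribution` — its coordinates are the values of `d` (on a fibre indicator of level
  `k` the Riemann sums of every level `≥ k` are constant, by iterated compatibility);
* `exists_measure_of_distribution` (SURJECTIVITY), `ofDistribution_toDistribution`, and
  `bijective_coord_on_bounded` — `Set.BijOn`: measures bounded by `C` ↔ compatible systems
  bounded by `C`, the set-level form of `A[[X]] ≅ lim_k A[F k]` for any complete ultrametric `A`
  (`W` included) and any presented `X`.

No printed input is consumed.  §8(d): uses an L-value-free non-vanishing device: NO.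
-/

namespace Summit.Ventures.HodgeRepro2.T5ProfiniteDistributionMeasure

open Summit.Ventures.HodgeRepro2.T5MeasureSupOnClopens (indicatorCM indicatorCM_apply)
open Summit.Ventures.HodgeRepro2.T5ProfiniteDistribution
open Finset Filter Topology

universe u v

variable {X : Type u} [MetricSpace X] (P : Presentation.{u, v} X)

section Lift

/-- A chosen point in the fibre over `a : F k` (the level maps are onto). -/
noncomputable def lift (k : ℕ) (a : P.F k) : X := (P.surjective_q k a).choose

/-- `P.q k (lift P k a) = a`. -/
@[simp] theorem q_lift (k : ℕ) (a : P.F k) : P.q k (lift P k a) = a :=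
  (P.surjective_q k a).choose_spec

/-- `lift P k a ∈ P.fiber k a`. -/
theorem lift_mem_fiber (k : ℕ) (a : P.F k) : lift P k a ∈ P.fiber k a := q_lift P k a

/-- The level-`k` image of a lift from level `k + 1` is the transition image. -/
theorem q_lift_succ (k : ℕ) (b : P.F (k + 1)) : P.q k (lift P (k + 1) b) = P.res k b := by
  rw [← P.res_q k, q_lift]

/-- Lifts from level `l + 1` and from level `l` through the transition map have the same image at
any level `k ≤ l`. -/
theorem q_lift_succ_eq {k l : ℕ} (h : k ≤ l) (c : P.F (l + 1)) :
    P.q k (lift P (l + 1) c) = P.q k (lift P l (P.res l c)) :=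
  P.q_eq_of_le h (by rw [q_lift_succ, q_lift])

end Lift

section Riemann

variable {A : Type*} [NormedCommRing A]

/-- The level-`k` Riemann sum of `φ` against the distribution `d`:
`Σ_{a ∈ F k} φ(â) · d k a`. -/
noncomputable def riemann (d : Distribution P A) (φ : C(X, A)) (k : ℕ) : A :=
  ∑ a : P.F k, φ (lift P k a) * d.val k a

/-- The bound of a distribution is non-negative. -/
theorem _root_.Summit.Ventures.HodgeRepro2.T5ProfiniteDistribution.Distribution.bound_nonneg
    [Nonempty X] {P : Presentation.{u, v} X} (d : Distribution P A) : 0 ≤ d.bound :=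
  (norm_nonneg _).trans (d.norm_le 0 (P.q 0 (Classical.arbitrary X)))

/-- Riemann sums are additive in `φ`. -/
theorem riemann_add (d : Distribution P A) (φ ψ : C(X, A)) (k : ℕ) :
    riemann P d (φ + ψ) k = riemann P d φ k + riemann P d ψ k := by
  simp only [riemann, ContinuousMap.add_apply, add_mul, Finset.sum_add_distrib]

/-- Riemann sums are `A`-linear in `φ`. -/
theorem riemann_smul (d : Distribution P A) (c : A) (φ : C(X, A)) (k : ℕ) :
    riemann P d (c • φ) k = c * riemann P d φ k := by
  simp only [riemann, ContinuousMap.smul_apply, smul_eq_mul, mul_assoc, Finset.mul_sum]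

/-- The level-`k` Riemann sum rewritten over level `k + 1` through the compatibility of `d`. -/
theorem riemann_eq_sum_succ (d : Distribution P A) (φ : C(X, A)) (k : ℕ) :
    riemann P d φ k = ∑ b : P.F (k + 1), φ (lift P k (P.res k b)) * d.val (k + 1) b := by
  unfold riemann
  rw [← Finset.sum_fiberwise univ (P.res k)]
  refine Finset.sum_congr rfl fun a _ => ?_
  rw [d.compat k a, Finset.mul_sum]
  refine Finset.sum_congr rfl fun b hb => ?_
  rw [(Finset.mem_filter.1 hb).2]

/-- `riemann (k+1) − riemann k = Σ_b (φ(b̂) − φ(r̂es b)) · d (k+1) b`. -/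
theorem riemann_succ_sub (d : Distribution P A) (φ : C(X, A)) (k : ℕ) :
    riemann P d φ (k + 1) - riemann P d φ k =
      ∑ b : P.F (k + 1), (φ (lift P (k + 1) b) - φ (lift P k (P.res k b))) * d.val (k + 1) b := by
  rw [riemann_eq_sum_succ P d φ k]
  unfold riemann
  rw [← Finset.sum_sub_distrib]
  refine Finset.sum_congr rfl fun b _ => ?_
  rw [sub_mul]

/-- Telescoping: `riemann n − riemann N = Σ_{j ∈ [N, n)} (riemann (j+1) − riemann j)`. -/
theorem riemann_sub_eq_sum_Ico (d : Distribution P A) (φ : C(X, A)) {N n : ℕ} (h : N ≤ n) :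
    riemann P d φ n - riemann P d φ N =
      ∑ j ∈ Finset.Ico N n, (riemann P d φ (j + 1) - riemann P d φ j) := by
  rw [Finset.sum_Ico_eq_sub _ h, Finset.sum_range_sub, Finset.sum_range_sub]
  abel

variable [IsUltrametricDist A]

/-- `‖riemann d φ k‖ ≤ bound · ‖φ‖` (ultrametric sum of terms bounded by `‖φ‖ · bound`). -/
theorem norm_riemann_le [CompactSpace X] [Nonempty X] (d : Distribution P A) (φ : C(X, A)) (k : ℕ) :
    ‖riemann P d φ k‖ ≤ d.bound * ‖φ‖ := by
  refine IsUltrametricDist.norm_sum_le_of_forall_le_of_nonneg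
    (mul_nonneg (d.bound_nonneg) (norm_nonneg φ)) fun a _ => ?_
  calc ‖φ (lift P k a) * d.val k a‖ ≤ ‖φ (lift P k a)‖ * ‖d.val k a‖ := norm_mul_le _ _
    _ ≤ ‖φ‖ * d.bound :=
        mul_le_mul (ContinuousMap.norm_coe_le_norm φ _) (d.norm_le k a) (norm_nonneg _)
          (norm_nonneg _)
    _ = d.bound * ‖φ‖ := mul_comm _ _

/-- The modulus-of-continuity bound on consecutive Riemann sums: if `φ` varies by at most `ε` on
each fibre of level `k` then `‖riemann (k+1) − riemann k‖ ≤ ε · bound`. -/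
theorem norm_riemann_succ_sub_le [Nonempty X] (d : Distribution P A) (φ : C(X, A)) {ε : ℝ} (hε : 0 ≤ ε)
    {k : ℕ} (h : ∀ x y : X, P.q k x = P.q k y → ‖φ x - φ y‖ ≤ ε) :
    ‖riemann P d φ (k + 1) - riemann P d φ k‖ ≤ ε * d.bound := by
  rw [riemann_succ_sub]
  refine IsUltrametricDist.norm_sum_le_of_forall_le_of_nonneg (mul_nonneg hε (d.bound_nonneg))
    fun b _ => ?_
  calc ‖(φ (lift P (k + 1) b) - φ (lift P k (P.res k b))) * d.val (k + 1) b‖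
      ≤ ‖φ (lift P (k + 1) b) - φ (lift P k (P.res k b))‖ * ‖d.val (k + 1) b‖ := norm_mul_le _ _
    _ ≤ ε * d.bound :=
        mul_le_mul (h _ _ (by rw [q_lift_succ, q_lift])) (d.norm_le _ _) (norm_nonneg _) hε

/-- THE RIEMANN SUMS ARE CAUCHY: uniform continuity of `φ` on the compact `X`, shrinking fibres,
the consecutive-difference bound and the ultrametric inequality on the telescoping sum. -/
theorem cauchySeq_riemann [CompactSpace X] [Nonempty X] (d : Distribution P A) (φ : C(X, A)) :
    CauchySeq (riemann P d φ) := by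
  rw [Metric.cauchySeq_iff']
  intro ε hε
  set ε' : ℝ := ε / (d.bound + 1) with hε'
  have hB : 0 < d.bound + 1 := by linarith [d.bound_nonneg]
  have hε'pos : 0 < ε' := div_pos hε hB
  obtain ⟨δ, hδ, hφ⟩ := Metric.uniformContinuous_iff.1
    (CompactSpace.uniformContinuous_of_continuous φ.continuous) ε' hε'pos
  obtain ⟨N, hN⟩ := P.exists_forall_shrink hδ
  refine ⟨N, fun n hn => ?_⟩
  have hstep : ∀ j, N ≤ j → ‖riemann P d φ (j + 1) - riemann P d φ j‖ ≤ ε' * d.bound := by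
    intro j hj
    refine norm_riemann_succ_sub_le P d φ hε'pos.le fun x y hxy => ?_
    have := hφ (hN j hj x y hxy)
    rw [dist_eq_norm] at this
    exact this.le
  rw [dist_eq_norm, riemann_sub_eq_sum_Ico P d φ hn]
  calc ‖∑ j ∈ Finset.Ico N n, (riemann P d φ (j + 1) - riemann P d φ j)‖ ≤ ε' * d.bound :=
        IsUltrametricDist.norm_sum_le_of_forall_le_of_nonneg
          (mul_nonneg hε'pos.le (d.bound_nonneg))
          fun j hj => hstep j (Finset.mem_Ico.1 hj).1
    _ < ε := by
        rw [hε', div_mul_eq_mul_div, div_lt_iff₀ hB]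
        nlinarith [d.bound_nonneg]

end Riemann

section OfDistribution

variable {A : Type*} [NormedCommRing A] [IsUltrametricDist A] [CompleteSpace A] [CompactSpace X]
  [Nonempty X]

/-- The limit of the Riemann sums. -/
noncomputable def limitRiemann (d : Distribution P A) (φ : C(X, A)) : A :=
  atTop.limUnder (riemann P d φ)

/-- The Riemann sums converge to `limitRiemann d φ`. -/
theorem tendsto_riemann (d : Distribution P A) (φ : C(X, A)) :
    Tendsto (riemann P d φ) atTop (𝓝 (limitRiemann P d φ)) :=
  (cauchySeq_riemann P d φ).tendsto_limUnder

/-- THE MEASURE OF A DISTRIBUTION: `φ ↦ lim_k Σ_{a ∈ F k} φ(â) · d k a`, `A`-linear. -/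
noncomputable def ofDistribution (d : Distribution P A) : C(X, A) →ₗ[A] A where
  toFun φ := limitRiemann P d φ
  map_add' φ ψ := by
    refine tendsto_nhds_unique (tendsto_riemann P d (φ + ψ)) ?_
    have h := (tendsto_riemann P d φ).add (tendsto_riemann P d ψ)
    refine h.congr' (Eventually.of_forall fun k => ?_)
    exact (riemann_add P d φ ψ k).symm
  map_smul' c φ := by
    refine tendsto_nhds_unique (tendsto_riemann P d (c • φ)) ?_
    have h := (tendsto_riemann P d φ).const_mul c
    refine h.congr' (Eventually.of_forall fun k => ?_)
    exact (riemann_smul P d c φ k).symm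

/-- `ofDistribution d φ = limitRiemann d φ`. -/
theorem ofDistribution_apply (d : Distribution P A) (φ : C(X, A)) :
    ofDistribution P d φ = limitRiemann P d φ := rfl

/-- The measure of a distribution is bounded by its bound. -/
theorem norm_ofDistribution_le (d : Distribution P A) (φ : C(X, A)) :
    ‖ofDistribution P d φ‖ ≤ d.bound * ‖φ‖ :=
  le_of_tendsto' (tendsto_riemann P d φ).norm fun k => norm_riemann_le P d φ k

omit [IsUltrametricDist A] [CompleteSpace A] [CompactSpace X] [Nonempty X] in
/-- Iterated compatibility: the value at level `k` is the sum of the values at any level `l ≥ k`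
over the points lying above (`b : F l` lies over `a : F k` iff its lift has level-`k` image `a`). -/
theorem _root_.Summit.Ventures.HodgeRepro2.T5ProfiniteDistribution.Distribution.val_eq_sum_of_le
    {P : Presentation.{u, v} X} (d : Distribution P A) {k l : ℕ} (h : k ≤ l) (a : P.F k) :
    d.val k a = ∑ b ∈ univ.filter (fun b : P.F l => P.q k (lift P l b) = a), d.val l b := by
  induction l, h using Nat.le_induction with
  | base =>
    simp only [q_lift]
    rw [Finset.sum_filter, Finset.sum_ite_eq' univ a (fun b => d.val k b)]
    simp
  | succ l hkl ih =>
    rw [ih, Finset.sum_congr rfl (fun b _ => d.compat l b)]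
    simp_rw [q_lift_succ_eq P hkl]
    rw [← Finset.sum_fiberwise_of_maps_to
      (s := univ.filter fun c : P.F (l + 1) => P.q k (lift P l (P.res l c)) = a)
      (t := univ.filter fun b : P.F l => P.q k (lift P l b) = a)
      (g := P.res l)
      (fun c hc => Finset.mem_filter.2 ⟨Finset.mem_univ _, (Finset.mem_filter.1 hc).2⟩)]
    refine Finset.sum_congr rfl fun b hb => Finset.sum_congr ?_ fun _ _ => rfl
    ext c
    simp only [Finset.mem_filter, Finset.mem_univ, true_and]
    constructor
    · intro hc
      refine ⟨?_, hc⟩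
      rw [hc]
      exact (Finset.mem_filter.1 hb).2
    · exact fun hc => hc.2

omit [IsUltrametricDist A] [CompleteSpace A] [CompactSpace X] [Nonempty X] in
/-- On the indicator of a fibre of level `k` the Riemann sums of level `l ≥ k` are the value
`d k a` itself. -/
theorem riemann_indicatorCM_fiber (d : Distribution P A) {k l : ℕ} (h : k ≤ l) (a : P.F k) :
    riemann P d (indicatorCM (P.fiber k a)) l = d.val k a := by
  classical
  unfold riemann
  rw [d.val_eq_sum_of_le h a, Finset.sum_filter]
  refine Finset.sum_congr rfl fun b _ => ?_
  rw [indicatorCM_apply (P.isClopen_fiber k a), Set.indicator_apply, Presentation.mem_fiber_iff]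
  split_ifs <;> simp

/-- The measure of a distribution has the distribution's values as its coordinates. -/
theorem coord_ofDistribution (d : Distribution P A) (k : ℕ) (a : P.F k) :
    P.coord (ofDistribution P d) k a = d.val k a := by
  rw [Presentation.coord_apply, ofDistribution_apply]
  refine tendsto_nhds_unique (tendsto_riemann P d _) ?_
  refine tendsto_const_nhds.congr' ?_
  rw [EventuallyEq, eventually_atTop]
  exact ⟨k, fun l hl => (riemann_indicatorCM_fiber P d hl a).symm⟩

/-- `P.coord (ofDistribution P d) = d.val`. -/
theorem coord_ofDistribution_eq (d : Distribution P A) : P.coord (ofDistribution P d) = d.val :=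
  funext fun k => funext fun a => coord_ofDistribution P d k a

/-- SURJECTIVITY: every bounded compatible system on the levels is the system of coordinates of
a bounded measure. -/
theorem exists_measure_of_distribution (d : Distribution P A) :
    ∃ m : C(X, A) →ₗ[A] A, (∀ φ : C(X, A), ‖m φ‖ ≤ d.bound * ‖φ‖) ∧ P.coord m = d.val :=
  ⟨ofDistribution P d, norm_ofDistribution_le P d, coord_ofDistribution_eq P d⟩

variable [NormOneClass A]

/-- `toDistribution (ofDistribution d)` has the values of `d`. -/
theorem toDistribution_ofDistribution_val (d : Distribution P A) :
    (P.toDistribution (ofDistribution P d) (d.bound_nonneg) (norm_ofDistribution_le P d)).val =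
      d.val :=
  coord_ofDistribution_eq P d

variable [T2Space X] [TotallyDisconnectedSpace X]

/-- `ofDistribution (toDistribution m) = m`: the two constructions are inverse to each other on
bounded measures (injectivity, T5ProfiniteDistribution). -/
theorem ofDistribution_toDistribution (m : C(X, A) →ₗ[A] A) {C : ℝ} (hC : 0 ≤ C)
    (hm : ∀ φ : C(X, A), ‖m φ‖ ≤ C * ‖φ‖) :
    ofDistribution P (P.toDistribution m hC hm) = m :=
  P.eq_of_coord_eq _ m hC (norm_ofDistribution_le P _) hm fun k a => coord_ofDistribution P _ k a

/-- The two constructions are inverse bijections between bounded measures (bounded by `C`) and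
bounded compatible systems (bounded by `C`): the set-level form of `A[[X]] ≅ lim_k A[F k]`. -/
theorem bijective_coord_on_bounded {C : ℝ} (hC : 0 ≤ C) :
    Set.BijOn (fun m : C(X, A) →ₗ[A] A => P.coord m)
      {m | ∀ φ : C(X, A), ‖m φ‖ ≤ C * ‖φ‖}
      {v : ∀ k : ℕ, P.F k → A | (∀ (k : ℕ) (a : P.F k),
        v k a = ∑ b ∈ univ.filter (fun b : P.F (k + 1) => P.res k b = a), v (k + 1) b) ∧
        ∀ (k : ℕ) (a : P.F k), ‖v k a‖ ≤ C} := by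
  refine ⟨fun m hm => ⟨P.coord_compat m, P.norm_coord_le m hC hm⟩, fun m₁ hm₁ m₂ hm₂ h => ?_, ?_⟩
  · exact P.eq_of_coord_eq m₁ m₂ hC hm₁ hm₂ fun k a => by
      have := congrFun (congrFun h k) a
      exact this
  · rintro v ⟨hcompat, hbound⟩
    let d : Distribution P A := ⟨v, hcompat, C, hbound⟩
    exact ⟨ofDistribution P d, norm_ofDistribution_le P d, coord_ofDistribution_eq P d⟩

end OfDistribution

end Summit.Ventures.HodgeRepro2.T5ProfiniteDistributionMeasure
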